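import Literature.NumberTheory.EllipticCurves.LocalKummerMap
import Literature.NumberTheory.GaloisRepresentations.AbsGaloisGroupProofs
import HarnessLib

/-!
# A rational point read in a bigger field of the tower has the same coordinates in `E(F̄)`

Topic `NumberTheory/EllipticCurves`; namespace `Literature.NumberTheory.EllipticCurves`. THEOREMS ONLY (no definition, no named fact,
no instance, no `sorry`). Coordinate bookkeeping for the restriction of Kummer classes / of the local Tate pairing with points along a tower
`K₀ ⊆ F₀ ⊆ F` (`LocalTatePairingRestriction`, hypothesis `hP`): for `P₀ ∈ E(F₀)` and `P = P₀` read in `E(F)`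
(`Affine.Point.map (F₀ → F)`), the point of `E(F̄) = localPoints W F` underlying `P` (through `toGeomPoints` and the tree's
`baseChangeGeomPointsEquiv`) is the image of the point of `E(F̄₀)` underlying `P₀` under the chosen `F₀`-embedding `ι : F̄₀ → F̄`
(`absClosureEmbedding F₀ F`) — both are `P₀`'s coordinates pushed to `F̄` (`F₀ → F → F̄` = `ι ∘ (F₀ → F̄₀)` on `F₀`).

* `baseChangeGeomPointsEquiv_toGeomPoints_map` — the statement above (the hypothesis `hP` of `tatePairingPoint_res` /
  `res_kummerLevelClass` for `P := P₀.map (F₀ → F)`).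

BSD is not advanced by this file (bookkeeping).

## References
* J. H. Silverman, *The Arithmetic of Elliptic Curves* (2009), VIII §1 (points over extensions, Galois action on coordinates). [SilvermanAEC2009]
-/

noncomputable section

open scoped Classical

open Field Function
open Literature.NumberTheory.GaloisRepresentations

namespace Literature.NumberTheory.EllipticCurves

open _root_.WeierstrassCurve

variable {K₀ : Type} [Field K₀] (W : WeierstrassCurve K₀)
  (F₀ : Type) [Field F₀] [Algebra K₀ F₀] (F : Type) [Field F] [Algebra K₀ F] [Algebra F₀ F] [IsScalarTower K₀ F₀ F]

/-- Two affine points with equal coordinates are equal. [folklore] -/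
private theorem some_eq_some {L : Type} [Field L] [Algebra K₀ L] {x y x' y' : L}
    (h : (W.baseChange L).toAffine.Nonsingular x y) (h' : (W.baseChange L).toAffine.Nonsingular x' y')
    (hx : x = x') (hy : y = y') :
    (WeierstrassCurve.Affine.Point.some x y h : (W.baseChange L).toAffine.Point) = .some x' y' h' := by
  subst hx hy; rfl

/-- **A rational point read in the bigger field of a tower has the same `F̄`-coordinates**: for `P₀ ∈ E(F₀)` and
`P = P₀.map (F₀ → F) ∈ E(F)`, the point of `E(F̄)` underlying `P` is `ι_*` of the point of `E(F̄₀)` underlying `P₀`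
(`ι = absClosureEmbedding F₀ F`; `F₀ → F → F̄` and `ι ∘ (F₀ → F̄₀)` agree on `F₀`). [cite: SilvermanAEC2009, VIII §1 (points over field extensions)] -/
theorem baseChangeGeomPointsEquiv_toGeomPoints_map (P₀ : (W.baseChange F₀).toAffine.Point) :
    (show (W.baseChange (AlgebraicClosure F)).toAffine.Point from
        W.baseChangeGeomPointsEquiv F (toGeomPoints (W.baseChange F)
          (WeierstrassCurve.Affine.Point.map (IsScalarTower.toAlgHom K₀ F₀ F) P₀))) =
      WeierstrassCurve.Affine.Point.map ((absClosureEmbedding F₀ F).restrictScalars K₀)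
        (show (W.baseChange (AlgebraicClosure F₀)).toAffine.Point from
          W.baseChangeGeomPointsEquiv F₀ (toGeomPoints (W.baseChange F₀) P₀)) := by
  rcases P₀ with _ | ⟨x, y, h⟩
  · rfl
  · -- all maps act on coordinates; the two composites `F₀ → F → F̄` and `ι ∘ (F₀ → F̄₀)` agree
    refine some_eq_some W _ _ ?_ ?_
    · change algebraMap F (AlgebraicClosure F) (algebraMap F₀ F x) = absClosureEmbedding F₀ F (algebraMap F₀ (AlgebraicClosure F₀) x)
      rw [AlgHom.commutes, ← IsScalarTower.algebraMap_apply]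
    · change algebraMap F (AlgebraicClosure F) (algebraMap F₀ F y) = absClosureEmbedding F₀ F (algebraMap F₀ (AlgebraicClosure F₀) y)
      rw [AlgHom.commutes, ← IsScalarTower.algebraMap_apply]

end Literature.NumberTheory.EllipticCurves

end
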